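import Mathlib.Analysis.SpecialFunctions.Pow.Real
import HarnessLib

/-!
# Voutier 2007, Theorem 2.1: an effective irrationality measure for the cube roots `(a/b)^{1/3}`
# (hypergeometric / Thue–Siegel method) — ONE named fact, and its form for all integers `q ≠ 0`

P. M. Voutier, *Rational approximations to `∛2` and other algebraic numbers revisited*, J. Théor.
Nombres Bordeaux **19** (2007) 263–288 (= arXiv:0802.1266), Theorem 2.1 (p. 3 of the arXiv version):

"Let `a` and `b` be integers satisfying `0 < b < a`. Define `c₁, d, E` and `κ` by
`d = 0` if `3 ∤ (a − b)`, `1` if `3 ∥ (a − b)` and `3/2` otherwise,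
`E = e^{−0.911} 3^d (a^{1/2} − b^{1/2})^{−2}`,
`κ = log{e^{0.911} 3^{−d} (a^{1/2} + b^{1/2})²} / log E` and `c₁ = 10^{40(κ+1)} a`.
If `E > 1` then `|(a/b)^{1/3} − p/q| > 1/(c₁|q|^{κ+1})` for all integers `p` and `q` with `q ≠ 0`."

An EFFECTIVE result (hypergeometric method: Padé approximants to `(1 − z)^{1/3}`, the arithmetic of
their denominators with the constant `e^{0.911}` of Lemma 3.3/§4, and the Thue–Siegel closing lemma —
the tree's `one_div_lt_abs_sub_div_of_approx`, `ApproximationSequenceMeasure.lean`); it is typed here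
as ONE named fact `VoutierCubicMeasure` (+1 declared debt: the denominator estimates of §§3–4 of the
source are not in the tree), in the Lean text requested by the `route-ABC-RootDecompF` lens seats
(`decomp-abc-lens-5`, v2.4): the branches of `d` as a nested `if` on `3 ∣ a − b`, `9 ∣ a − b`
(`3 ∥ (a − b)` = "`3 ∣ a − b` and `9 ∤ a − b`"), `d, E, κ` bound by their defining equations, `q`
ranging over the POSITIVE integers (the printed `q ≠ 0` form is recovered in
`VoutierCubicMeasure.of_ne_zero`, proved: `|q|` and `p ↦ −p`), the cube root as the real power
`((a : ℝ)/b)^{(1/3 : ℝ)}`.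

* `VoutierCubicMeasure` — the named fact (Theorem 2.1 verbatim, `q ≥ 1`);
* `VoutierCubicMeasure.of_ne_zero` — PROVED: the fact gives the printed form for all integers
  `q ≠ 0` with `|q|^{κ+1}`.

## References

* [Voutier2007] P. M. Voutier, J. Théor. Nombres Bordeaux 19 (2007) 263–288, Theorem 2.1 and the
  Remark after it (the constants `10^{7(κ+1)}` / `10^{86(κ+1)}` / `10^{2400(κ+1)}` for `0.93` / `0.91`
  / `0.907`), Corollary 2.2 (Table 1); arXiv:0802.1266 p. 3.
* [ChenVoutier1997] Chen J. H., P. M. Voutier, J. Number Theory 62 (1997), §2 Lemma 8 (the closing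
  lemma; the tree's `ApproximationSequenceMeasure.lean`).
-/

noncomputable section

namespace Literature.NumberTheory.DiophantineApproximation

open Real

/-- **Voutier 2007, Theorem 2.1 (effective irrationality measure for `(a/b)^{1/3}`; named fact).**
For integers `0 < b < a` put `d = 0, 1, 3/2` according as `3 ∤ (a−b)`, `3 ∥ (a−b)`, `9 ∣ (a−b)`;
`E = e^{−0.911}·3^d·(√a − √b)^{−2}`; `κ = log(e^{0.911}·3^{−d}·(√a + √b)²)/log E`. If `E > 1` then for
all integers `p` and `q ≥ 1`, `|(a/b)^{1/3} − p/q| > 1/(10^{40(κ+1)}·a·q^{κ+1})`. The data `d, E, κ` are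
bound by their defining equations (no `let`); `3 ∥ (a − b)` is "`3 ∣ a − b ∧ ¬ 9 ∣ a − b`"; the
printed range "`q ≠ 0`" is `VoutierCubicMeasure.of_ne_zero`. +1 declared debt (the denominator
arithmetic of §§3–4 of the source, constant `e^{0.911}`, is not in the tree; the closing lemma is:
`one_div_lt_abs_sub_div_of_approx`). [cite: Voutier2007, Theorem 2.1 (arXiv:0802.1266 p. 3)] -/
def VoutierCubicMeasure : Prop :=
  ∀ a b : ℕ, 0 < b → b < a → ∀ d E κ : ℝ,
    d = (if 3 ∣ a - b then (if 9 ∣ a - b then 3 / 2 else 1) else 0) →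
    E = Real.exp (-0.911) * (3 : ℝ) ^ d * (Real.sqrt a - Real.sqrt b)⁻¹ ^ 2 →
    κ = Real.log (Real.exp 0.911 * (3 : ℝ) ^ (-d) * (Real.sqrt a + Real.sqrt b) ^ 2) / Real.log E →
    1 < E →
    ∀ (p : ℤ) (q : ℕ), 0 < q →
      1 / ((10 : ℝ) ^ (40 * (κ + 1)) * a * (q : ℝ) ^ (κ + 1)) < |((a : ℝ) / b) ^ (1 / 3 : ℝ) - p / q|

/-- **The printed range `q ≠ 0`**: from the fact, for all integers `p` and `q ≠ 0`,
`|(a/b)^{1/3} − p/q| > 1/(10^{40(κ+1)}·a·|q|^{κ+1})` (for `q < 0` apply the fact to `(−p, −q)`: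
`(−p)/(−q) = p/q`). [cite: Voutier2007, Theorem 2.1 ("for all integers `p` and `q` with `q ≠ 0`")] -/
theorem VoutierCubicMeasure.of_ne_zero (h : VoutierCubicMeasure) (a b : ℕ) (hb : 0 < b) (hab : b < a)
    (d E κ : ℝ) (hd : d = (if 3 ∣ a - b then (if 9 ∣ a - b then 3 / 2 else 1) else 0))
    (hE : E = Real.exp (-0.911) * (3 : ℝ) ^ d * (Real.sqrt a - Real.sqrt b)⁻¹ ^ 2)
    (hκ : κ = Real.log (Real.exp 0.911 * (3 : ℝ) ^ (-d) * (Real.sqrt a + Real.sqrt b) ^ 2) / Real.log E)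
    (hE1 : 1 < E) (p q : ℤ) (hq : q ≠ 0) :
    1 / ((10 : ℝ) ^ (40 * (κ + 1)) * a * (|(q : ℝ)|) ^ (κ + 1)) <
      |((a : ℝ) / b) ^ (1 / 3 : ℝ) - p / q| := by
  have key := h a b hb hab d E κ hd hE hκ hE1
  rcases lt_or_gt_of_ne hq with hneg | hpos
  · -- `q < 0`: use `(−p, −q)`
    have hn : 0 < q.natAbs := Int.natAbs_pos.2 hq
    have h1 := key (-p) q.natAbs hn
    have hq' : ((q.natAbs : ℕ) : ℝ) = -(q : ℝ) := by
      rw [Nat.cast_natAbs, Int.cast_abs, abs_of_neg (by exact_mod_cast hneg)]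
    rw [hq'] at h1
    have habs : |(q : ℝ)| = -(q : ℝ) := abs_of_neg (by exact_mod_cast hneg)
    rw [habs]
    have hfrac : ((-p : ℤ) : ℝ) / -(q : ℝ) = (p : ℝ) / q := by
      push_cast
      rw [neg_div_neg_eq]
    rwa [hfrac] at h1
  · -- `q > 0`
    have hn : 0 < q.toNat := by omega
    have h1 := key p q.toNat hn
    have hq' : ((q.toNat : ℕ) : ℝ) = (q : ℝ) := by
      have : (q.toNat : ℤ) = q := Int.toNat_of_nonneg hpos.le
      exact_mod_cast this
    rw [hq'] at h1
    rwa [abs_of_pos (by exact_mod_cast hpos : (0 : ℝ) < q)]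

end Literature.NumberTheory.DiophantineApproximation

end
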